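import Mathlib
import HarnessLib
import HarnessLib.Audit
import Summits.HodgeConjecture.Statement
import Literature.AlgebraicGeometry.Motives.FamiliesVHS
import Literature.AlgebraicGeometry.Motives.Sweep1
import Literature.AlgebraicGeometry.HodgeTheory.GysinFormalism
import Summits.HodgeConjecture.HodgeConjecture.Theorems.HolomorphicDefectHodgeModelsExist
import HarnessLib.Audit.Status.Attr

/-!
Route: FiniteTreeOfFlavours

DORMANT since 2026-08-26T20:20:51Z (reconciler: no traction for 5 d (last activity item-evidence-added at 2026-08-21T19:41:25Z); parked, not closed — `ledger route dormant route-HodgeConjecture-FiniteTreeOfFlavours --off` to reactivate) — unstaffed, not closed; items shared with open routes are served there. `ledger route dormant <id> --off` reactivates.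

# Route FiniteTreeOfFlavours — HodgeConjecture (idea card bku-finite-tree-of-flavours; plancard
planner, 2026-08-15)

## Thesis X (it suffices to show X) — a SUB-FAMILY route (smooth hypersurfaces)
Words: the Hodge conjecture for every smooth hypersurface X ⊂ P^{n+1}_C of every degree d (target
`HypersurfaceHodge`),
attacked through the MOVABLE / RIGID dichotomy of Hodge classes that the Baldi–Klingler–Ullmo
structure theorem of the Hodge
locus suggests: a rational (k,k)-class c on X MOVES if it is the restriction of a rational
(k,k)-class Λ on a smooth projective
(n+1)-fold 𝒴 → C (C a smooth projective curve) having X as a fibre and only finitely many fibres ≅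
X; otherwise c is RIGID.
For n ≥ 3, d ≥ 3 "c moves" ⟺ "the component through [X] of the Hodge locus of c in U_{n,d}/PGL is
positive-dimensional"
(curve section + smooth compactification + global invariant cycle theorem + semisimplicity;
conversely deformations of
hypersurfaces of dim ≥ 3 stay hypersurfaces and the moduli of smooth hypersurfaces is separated).
Lean (target): `∀ ⦃n d : ℕ⦄ ⦃X : Literature.AlgebraicGeometry.Motives.SchemeOver ℂ⦄,
Literature.AlgebraicGeometry.Motives.IsSmoothHypersurface n d X →
Literature.AlgebraicGeometry.HodgeTheory.HodgeConjectureFor n X`.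
X = MovableClassesAlgebraic ∧ RigidImpliesQbar ∧ RigidQbarClassesAlgebraic (+ Hodge-model existence,
the support item
`HodgeModelsExist` = the known theorem Serre GAGA + de Rham + Hodge decomposition, written out over
`HodgeModel`; shared item
stmt-HodgeConjecture-2742), by the tautological movable/rigid case split (the deciding theorem
`closes`, pure logic).

## Assembly X → HodgeConjecture
`Assembly := HodgeModelsExist → MovableClassesAlgebraic → RigidImpliesQbar →
RigidQbarClassesAlgebraic → HypersurfacesSuffice →
HodgeConjecture` — exactly the type of the deciding theorem `closes` (D-0027 §2.1, proved in this
file by pure logic; rev 2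
route-repair: the Literature named fact `nonempty_hodgeModel` is no longer imported or assumed). The
summit is reached only through the
support item `HypersurfacesSuffice` = the OPEN reduction "cycle part of HC for smooth hypersurfaces
⟹ cycle part of HC for all
smooth projective varieties", for which NO mechanism is claimed (Thomas2005Nodes, Thm 1, reduces HC
to nodal hypersurface
SECTIONS of a given X, not to hypersurfaces of P^N). This route's deliverable is X; the bridge is a
scope marker.

Rationale: WHY THIS LINE. For the universal family U_{n,d} of smooth hypersurfaces (n ≥ 3, d ≥ 6: level ≥ 3,
BaldiKlinglerUllmo2024 Thm 2.3/2.6,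
Cor 2.7) the typical Hodge locus is EMPTY and the positive-period-dimensional Hodge locus is a
FINITE union of maximal atypical special
subvarieties Z_1..Z_N: o-minimality (definable period maps + Ax–Schanuel) turns "all hypersurfaces
carrying a movable Hodge class" into
finitely many families per (n,d), each constrained by big monodromy (André–Deligne: G_Z ⊇ algebraic
monodromy), IVHS/Jacobian rings
(Griffiths–Harris, Otwinowska2002, Villaflorloyola2021) and effective enumeration (Urbanik2023).
What is left — RIGID classes (isolated
points of Hodge loci mod PGL, incl. all CM hypersurfaces) — is an ARITHMETIC problem: such points
should be Q̄-points (the residual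
case of KlinglerOtwinowskaUrbanik2023 Cor 1.14; Voisin2007HodgeLoci; Saito–Schnell arXiv:1408.2488)
and HC there runs on absolute-Hodge /
CM engines (Shioda1979HodgeFermat, Deligne1982HodgeCycles). Imported area: o-minimal/transcendence
theory of period maps (tameness);
catalogue item used: "tameness/definability — general finiteness and counting"; no
spectral/probabilistic/physical analogy used.
RANKED CRUXES. (2) MovableClassesAlgebraicSextic — the (4,6) testbed: movable rational (2,2)-classes
on smooth sextic fourfolds are
algebraic; the finite tree is COMPUTABLE here (h^{3,1} = 426 bounds codimensions; Urbanik2023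
enumerates special subvarieties of bounded
degree; flag loci {X ⊇ S}, S a surface of low degree, are the candidate explanations; kit compute
for IVHS ranks). (3) MovableClassesAlgebraic
— all (n,d,k): every movable class is algebraic = "every positive-dimensional special subvariety of
vector type is cycle-explained at its
generic point" + specialisation; first layer finite by BKU, deeper layers finite only while the
adjoint level of G_Z stays ≥ 3 (else
Shimura-type nodes: abelian-motive engines). (4) RigidImpliesQbar — a rigid class forces X ≅ V(F)
with F over Q̄ (HC implies it:
spread out (X, cycle) over a Q̄-variety S; if X has no Q̄-model a curve in S through the generic
point gives a non-isotrivial family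
along which c stays algebraic, i.e. c moves). (5) RigidQbarClassesAlgebraic — HC for rigid classes
on Q̄-hypersurfaces (CM/Fermat
sub-case: Shioda m prime or ≤ 20 known, m = 21.. open; non-CM rigid classes: existence itself open —
support item NonCMRigidClassExists).
Target rank 0; Assembly rank 1 = the type of the deciding theorem `closes` (proved in the route
file, pure logic); bridge
HypersurfacesSuffice = support (open, unstaffed by design); support HodgeModelsExist = Hodge-model
existence for smooth projective
varieties (known theorem: Serre GAGA + de Rham + Hodge decomposition; shared item
stmt-HodgeConjecture-2742; supplies the anti-vacuity
conjunct of HodgeConjectureFor in `closes` — the Literature named fact nonempty_hodgeModel is no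
longer imported).
KILL CRITERIA (mechanism level; every typed crux is implied by HC, so a typed refutation refutes HC
itself): K1 — a maximal
positive-dimensional component of the Hodge locus of U_{4,6} whose generic Hodge vector is provably
not in the span of h^2 and classes of
surfaces of degree ≤ 36 (Otwinowska-type bound) — census ⟹ close `exhausted` (mechanism dead for
(4,6)); K2 — a certified rigid Hodge
class on a hypersurface with a transcendental modulus (refutes RigidImpliesQbar AND HodgeConjecture;
cf. card two-attractor-transcendence-test);
K3 — a node Z ⊂ U_{4,6} of adjoint level ≤ 2 with dense unexplained sub-loci (finite-tree
bookkeeping fails; route must import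
abelian-motive engines or close).
NOT DECOMPOSED YET. No split of (3) by (n,d) beyond the (4,6) testbed; no separate CM item under (5)
until (4,6) or a Fermat case moves;
BKU Thm 2.6 and 'special subvariety of vector type' are not yet Lean notions (definition request +
cite item filed) — the typed cruxes
avoid VHS hypothesis structures on purpose (∀ B : BettiHodgeData statements are refutable for junk
reasons, cf. Motives/Sweep1
docstrings) and speak only about honest singular cohomology of complex points, fibres `fiberOver`,
`complexBetti.map`.
CHEAPEST FALSIFIER. K1 run as a computation on the (4,6) testbed (crux
MovableClassesAlgebraicSextic): exhibit ONE positive-dimensional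
component of the Hodge locus of vector type in U_{4,6} (smooth sextic fourfolds, h^{3,1} = 426
bounds its codimension) that is contained in
no flag locus {X ⊇ S} of surfaces S of degree ≤ 36 (Otwinowska-type degree bound) — decidable by
IVHS / Jacobian-ring rank computations
at a well-chosen point (Macaulay2-style, kit compute; Otwinowska2002, Villaflorloyola2021,
arXiv:2104.14845). One such component kills the
finite-tree mechanism for (4,6) and closes the route `exhausted`; cheaper still, a literature hit
for an NL/Hodge-locus component of sextic
fourfolds not explained by surface classes (searched 2026-08-15, none found: see Novelty).
SOURCES. BaldiKlinglerUllmo2024, BaldiKlinglerUllmo2024NL, KlinglerOtwinowskaUrbanik2023,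
Voisin2007HodgeLoci, CattaniDeligneKaplan1995JAMS,
Otwinowska2002, Urbanik2023, Villaflorloyola2021, Thomas2005Nodes, Shioda1979HodgeFermat,
arXiv:1408.2488, arXiv:2104.14845, arXiv:1404.7519, arXiv:2112.14818.

Novelty: Nearest prior art (searched 2026-08-15: lit read arXiv:2107.08838 = BaldiKlinglerUllmo2024 §2 (Thm
2.3, 2.6, Cor 2.7; p.5 "we can't say anything on the atypical locus of zero period dimension"); lit
read arXiv:2010.03359 = KlinglerOtwinowskaUrbanik2023 §1 (Cor 1.13: maximal positive-dimensional
special subvarieties defined over Q̄; Cor 1.14: the general case reduces to special POINTS); lit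
read Thomas2005Nodes Thm 1 (nodal sections, not hypersurfaces of P^N); zbMATH: Otwinowska2002
(small-codimension NL components = linear-subspace loci, 'asymptotic argument in favour of HC for
hypersurfaces'), Villaflorloyola2021 and Movasati arXiv:1411.1766 / arXiv:1908.04117 (components of
the Hodge locus through Fermat), Dan arXiv:1404.7519 and Kloosterman arXiv:2104.14845 (variational
HC on NL/flag loci of hypersurfaces), Saito–Schnell arXiv:1408.2488, Urbanik2023 (effective
enumeration of special subvarieties of bounded degree), BaldiKlinglerUllmo2024NL (non-density of
exceptional NL components); card audit r14 graded the card new-combination). Delta: none of these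
states or uses the equivalence HC(smooth hypersurfaces) ⟺ [movable classes algebraic] ∧ [rigid
classes live on Q̄-hypersurfaces] ∧ [rigid classes on Q̄-hypersurfaces algebraic], with 'movable'
typed intrinsically (restriction of a Hodge class from a smooth total space of a non-isotrivial
pencil) so that BKU finiteness makes the movable half a finite classification per (n,d) and KOU's
open point-case becomes an explicit crux;  [refs: 2107.08838, 2010.03359, 1411.1766, 1908.04117, 1404.7519, 2104.14845, 1408.2488, BaldiKlinglerUllmo2024, KlinglerOtwinowskaUrbanik2023, Otwinowska2002, Villaflorloyola2021, Urbanik2023]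

Barriers (technique_class: o-minimality, noether-lefschetz-locus, field-of-definition): - Literature.Barriers.HodgeConjecture.CattaniDeligneKaplan1995_hodgeLocus_algebraicFor: proof-side
route that USES algebraicity of the Hodge locus (indeed its o-minimal sharpening BKU Thm 2.6); the
barrier only blocks refutations by non-algebraic loci. Its listed evasion — the uncontrolled FIELD
OF DEFINITION — is exactly crux RigidImpliesQbar (points) and KOU Cor 1.13 (positive-dimensional
maximal nodes, known).
- Literature.Barriers.HodgeConjecture.hodgeClassesAreAbsoluteFor_abelianVariety: the
Galois-conjugation no-go concerns REFUTING HC on abelian varieties; here abelian-type Hodge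
structures occur only at CM/rigid leaves (crux RigidQbarClassesAlgebraic), where the route is
proof-side and may import Deligne's absolute-Hodge theorem as an engine; positive-dimensional nodes
have orthogonal/symplectic generic Mumford–Tate groups of level ≥ 3, outside the barrier's scope;
kill criterion K2 (a transcendental rigid point on a level ≥ 3 HYPERSURFACE family) is not a Galois
test on an abelian variety.
- Literature.Barriers.HodgeConjecture.Voisin2003_generalHypersurface_noIntegralClassInF: no
Lefschetz pencil / normal function / Jacobi inversion is used; the induction runs over the
special-subvariety stratification of the PARAMETER space U_{n,d}, and the very general hypersurface
(empty typical locus, BKU Thm 2.3) carries no primitive Hodge class at all, so nothing is asked of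
it.
- Literature.Barriers.HodgeConjecture.Grothendieck1969_generalHodgeConjecture_false: no classwise co

Novelty grade: new-combination — Refuter route-review 5e953109, 2026-08-15 (searchd DOWN; crossref 'Hodge locus hypersurfaces field of definition special points Klingler Otwinowska Urbanik' -> KOU 2023, Klingler-Otwinowska 2021, Otwinowska 2002, BKU 2023, Dan 2017, Urbanik 2022; + planner's documented reads of arXiv:2107.08838 §2,  (refuter refuter-rreview-route-AnomalousDissipati-5e953109-0, 2026-08-15T14:02:31Z; prior: doi:10.1007/s00222-023-01226-0 (Baldi-Klingler-Ullmo, distribution of the Hodge locus = arXiv:2107.08838), doi:10.24033/asens.2555 (Klingler-Otwinowska-Urbanik 2023, fields of definition of Hodge loci = arXiv:2010.03359), doi:10.1007/s00222-021-01042-4 (Klingler-Otwinowska 2021, closure of the positive-period-dimension Hodge locus), doi:10.1090/s1056-3911-02-00349-1 (Otwinowska 2002, small-codimen)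

History (route lifecycle, newest last):
- 2026-08-15T16:24:07Z · rev 2: restated Assembly (stmt-HodgeConjecture-1497) — route-repair (glue.missing + glue.extra-hypothesis; cone debt nonempty_hodgeModel): (1) import Literature.AlgebraicGeometry.HodgeTheory.HodgeModelExistence DROP (planner-rbadge-HodgeConjecture-FiniteTreeOfFla-060ab0f9-g2-0)
- 2026-08-16T03:19:59Z · rev 3: dropped HypersurfaceHodgeOfCruxes — route-choice (target-unreachable, option a) — render-order fix: drop HypersurfaceHodgeOfCruxes (stmt-HodgeConjecture-14222, rank 9, rendered before HodgeModelsE (planner-rchoice-HodgeConjecture-FiniteTreeOfFl-bc3537c9-0)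
- 2026-08-26T20:20:51Z · DORMANT — reconciler: no traction for 5 d (last activity item-evidence-added at 2026-08-21T19:41:25Z); parked, not closed — `ledger route dormant route-HodgeConjecture-Fi (operator:999:2224294)

sub-problem: HodgeConjecture · status: dormant · opened planner-plancard-HodgeConjecture-HodgeConject-be5e55c4-0 2026-08-15T10:56:50Z · rev 3 · ledger route-HodgeConjecture-FiniteTreeOfFlavours
GENERATED by the gate from the ledger (D-0016/17). Provers cite these decls: `theorem foo : Summit.HodgeConjecture.HodgeConjecture.Theses.FiniteTreeOfFlavours.<Decl> := …` in Summits/HodgeConjecture/HodgeConjecture/Theorems/<Name>.lean.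
-/

namespace Summit.HodgeConjecture.HodgeConjecture.Theses.FiniteTreeOfFlavours

open scoped BigOperators Topology Manifold Classical MeasureTheory ProbabilityTheory Matrix InnerProductSpace ComplexConjugate ContinuousMap
open Filter Set Function TopologicalSpace MeasureTheory

attribute [summit_statement] _root_.HodgeConjecture

/-- item stmt-HodgeConjecture-1491 · target · rank 0 · open · by planner
why it might fail: As typed it includes the conjunct Nonempty (HodgeModel n X) for hypersurfaces: beyond the three cruxes it needs Hodge-model existence (fact nonempty_hodgeModel = prepared support item HodgeModelsExist; known theorem, XL to formalise). Cycle part fails iff HC fails on a smooth hypersurface.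
sources: Deligne2000, BaldiKlinglerUllmo2024, Zucker1977CubicFourfolds, ConteMurre1978, Shioda1979HodgeFermat
[target] Thesis X: the Hodge conjecture (Hodge model + every rational (k,k)-class in H^{2k}(X(C);C)
lies in N^k = algebraicClasses) for every smooth hypersurface X in P^{n+1}_C of every dimension n
and degree d. Follows from MovableClassesAlgebraic + RigidImpliesQbar + RigidQbarClassesAlgebraic +
the Literature fact nonempty_hodgeModel by the tautological movable/rigid case split (evidence:
Sketch2.lean target_holds, rc 0). Classical sub-cases: d <= 2, n <= 3 (Lefschetz (1,1) + hard
Lefschetz), (4,3) Zucker1977CubicFourfolds, (4,4),(4,5) ConteMurre1978, Fermat m prime or <= 20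
Shioda1979HodgeFermat; the BKU finite-tree regime is n >= 3, d >= 6 (BaldiKlinglerUllmo2024 Cor
2.7). -/
@[route_item "route-HodgeConjecture-FiniteTreeOfFlavours"]
def HypersurfaceHodge : Prop :=
  ∀ ⦃n d : ℕ⦄ ⦃X : Literature.AlgebraicGeometry.Motives.SchemeOver ℂ⦄, Literature.AlgebraicGeometry.Motives.IsSmoothHypersurface n d X → Literature.AlgebraicGeometry.HodgeTheory.HodgeConjectureFor n X

/-- item stmt-HodgeConjecture-1492 · crux · rank 2 · open · by planner
why it might fail: False iff HC fails along a positive-dimensional family of sextic fourfolds: a maximal atypical component of the Hodge locus of U_{4,6} (codim <= h^{3,1} = 426) whose generic Hodge vector is no combination of surface classes; only small-codimension components are classified so far.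
sources: BaldiKlinglerUllmo2024, Otwinowska2002, Villaflorloyola2021, Urbanik2023, arXiv:2104.14845, arXiv:1404.7519
[crux] (4,6) TESTBED of the finite tree. A rational (2,2)-class c on a smooth sextic fourfold X
MOVES (:= is the restriction of a rational (2,2)-class Lambda on a smooth projective 5-fold Y -> C
over a smooth projective curve, X = a fibre, only finitely many fibres isomorphic to X; for
hypersurfaces of dim >= 3 this says: the Hodge locus of c through [X] in U_{4,6}/PGL is
positive-dimensional) => c is algebraic. Mechanism: by BKU Thm 2.6/Cor 2.7 (level >= 3) the movable
pairs lie over FINITELY many maximal atypical special subvarieties Z_1..Z_N of U_{4,6} (codim Z_i <=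
h^{3,1} = 426); classify them using big monodromy (G_Z contains the algebraic monodromy),
IVHS/Jacobian-ring rank conditions (Griffiths-Harris; Otwinowska2002: small codimension => X
contains a plane; Villaflorloyola2021 near Fermat) and Urbanik2023's effective enumeration of
special subvarieties of bounded degree; show each Z_i (and recursively its sub-nodes while the
adjoint level stays >= 3) is a component of a flag locus {X containing S}, S a surface, with generic
Hodge vector [S] - (deg S/6) h^2 (variational HC on flag loci: Dan arXiv:1404.7519, Kloosterman
arXiv:2104.14845); conclude by specialisation of algebr -/
@[route_item "route-HodgeConjecture-FiniteTreeOfFlavours"]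
def MovableClassesAlgebraicSextic : Prop :=
  ∀ ⦃X : Literature.AlgebraicGeometry.Motives.SchemeOver ℂ⦄, Literature.AlgebraicGeometry.Motives.IsSmoothHypersurface 4 6 X → ∀ c : Literature.AlgebraicGeometry.HodgeTheory.complexBetti X (2 * 2), Literature.AlgebraicGeometry.HodgeTheory.IsRationalClass c → Literature.AlgebraicGeometry.HodgeTheory.IsOfHodgeType 4 X (2 * 2) 2 2 c → (∃ (𝒴 C : Literature.AlgebraicGeometry.Motives.SchemeOver ℂ) (π : 𝒴 ⟶ C) (t : Literature.AlgebraicGeometry.Motives.AlgPoints C ℂ) (e : X ≅ Literature.AlgebraicGeometry.Motives.fiberOver π t) (Λ : Literature.AlgebraicGeometry.HodgeTheory.complexBetti 𝒴 (2 * 2)), Literature.AlgebraicGeometry.Motives.IsSmoothProjective (4 + 1) 𝒴 ∧ Literature.AlgebraicGeometry.Motives.IsSmoothProjective 1 C ∧ Literature.AlgebraicGeometry.HodgeTheory.IsRationalClass Λ ∧ Literature.AlgebraicGeometry.HodgeTheory.IsOfHodgeType (4 + 1) 𝒴 (2 * 2) 2 2 Λ ∧ (Literature.AlgebraicGeometry.HodgeTheory.complexBetti.map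 (CategoryTheory.CategoryStruct.comp e.hom (Literature.AlgebraicGeometry.Motives.fiberι π t)) (2 * 2)).hom Λ = c ∧ Set.Finite {t' : Literature.AlgebraicGeometry.Motives.AlgPoints C ℂ | Nonempty (Literature.AlgebraicGeometry.Motives.fiberOver π t' ≅ X)}) → c ∈ Literature.AlgebraicGeometry.HodgeTheory.algebraicClasses X 2

/-- item stmt-HodgeConjecture-1493 · crux · rank 3 · open · by planner
why it might fail: A flat family of Hodge classes over a positive-dimensional family of hypersurfaces explained by no relative cycle would be an HC counterexample family; and below the first BKU layer the tree may be infinite (adjoint level of G_Z can drop to <= 2), so finiteness alone proves nothing.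
sources: BaldiKlinglerUllmo2024, BaldiKlinglerUllmo2024NL, KlinglerOtwinowskaUrbanik2023, Otwinowska2002, VoisinHodgeII2003, arXiv:2104.14845
[crux] General movable half: for every smooth (n,d)-hypersurface X and every rational (k,k)-class c
in H^{2k}(X(C);C) that MOVES (restriction of a rational (k,k)-class on a smooth projective
(n+1)-fold fibred over a smooth projective curve with X a fibre and only finitely many fibres
isomorphic to X), c is algebraic. Equivalent (n >= 3, d >= 3) to: every positive-dimensional special
subvariety of VECTOR type of (U_{n,d}, R^n_prim) is cycle-explained at its generic point (then
specialise). Trivial instances included on purpose (no Lefschetz facts needed in the assembly): c =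
q h^k moves along a general pencil (d >= 3) and is algebraic; 2k != n gives only such classes.
Engines: BKU finiteness of maximal atypical families for n >= 3, d >= 6 (BaldiKlinglerUllmo2024 Thm
2.6, Cor 2.7; non-density of exceptional NL components BaldiKlinglerUllmo2024NL), Q-bar-definability
of maximal nodes (KlinglerOtwinowskaUrbanik2023 Cor 1.13), NL/IVHS explanation (Otwinowska2002,
VoisinHodgeII2003 ch. 5-6, Green), variational HC on flag loci (arXiv:1404.7519, arXiv:2104.14845);
below the first layer finiteness persists only while the adjoint level of G_Z stays >= 3 —
Shimura-type nodes need abelian-moti -/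
@[route_item "route-HodgeConjecture-FiniteTreeOfFlavours", crux]
def MovableClassesAlgebraic : Prop :=
  ∀ ⦃n d : ℕ⦄ ⦃X : Literature.AlgebraicGeometry.Motives.SchemeOver ℂ⦄, Literature.AlgebraicGeometry.Motives.IsSmoothHypersurface n d X → ∀ (k : ℕ) (c : Literature.AlgebraicGeometry.HodgeTheory.complexBetti X (2 * k)), Literature.AlgebraicGeometry.HodgeTheory.IsRationalClass c → Literature.AlgebraicGeometry.HodgeTheory.IsOfHodgeType n X (2 * k) k k c → (∃ (𝒴 C : Literature.AlgebraicGeometry.Motives.SchemeOver ℂ) (π : 𝒴 ⟶ C) (t : Literature.AlgebraicGeometry.Motives.AlgPoints C ℂ) (e : X ≅ Literature.AlgebraicGeometry.Motives.fiberOver π t) (Λ : Literature.AlgebraicGeometry.HodgeTheory.complexBetti 𝒴 (2 * k)), Literature.AlgebraicGeometry.Motives.IsSmoothProjective (n + 1) 𝒴 ∧ Literature.AlgebraicGeometry.Motives.IsSmoothProjective 1 C ∧ Literature.AlgebraicGeometry.HodgeTheory.IsRationalClass Λ ∧ Literature.AlgebraicGeometry.HodgeTheory.IsOfHodgeType (n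 + 1) 𝒴 (2 * k) k k Λ ∧ (Literature.AlgebraicGeometry.HodgeTheory.complexBetti.map (CategoryTheory.CategoryStruct.comp e.hom (Literature.AlgebraicGeometry.Motives.fiberι π t)) (2 * k)).hom Λ = c ∧ Set.Finite {t' : Literature.AlgebraicGeometry.Motives.AlgPoints C ℂ | Nonempty (Literature.AlgebraicGeometry.Motives.fiberOver π t' ≅ X)}) → c ∈ Literature.AlgebraicGeometry.HodgeTheory.algebraicClasses X k

/-- item stmt-HodgeConjecture-1494 · crux · rank 4 · open · by planner
why it might fail: False iff a hypersurface with transcendental moduli carries a Hodge class surviving on no non-isotrivial 1-parameter deformation — an isolated transcendental point of a Hodge locus, which would also refute HC; CDK leave the field of definition open, KOU Cor 1.14: points are THE open case.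
sources: KlinglerOtwinowskaUrbanik2023, Voisin2007HodgeLoci, arXiv:1408.2488, CattaniDeligneKaplan1995JAMS, BaldiKlinglerUllmo2024
[crux] Field of definition of RIGID classes: if a smooth (n,d)-hypersurface X carries a rational
(k,k)-class c that does NOT move (no smooth projective (n+1)-fold over a curve through X,
non-isotrivial at X, carries a rational (k,k)-class restricting to c), then X is isomorphic to V(F)
for a form F of degree d with algebraic coefficients. This is implied by HC (spread out (X, cycle)
over a Q-bar-variety S: if X has no Q-bar-model, a complex curve in S through the generic point not
contained in the isotriviality locus gives a non-isotrivial smooth family along which c stays a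
cycle class, i.e. c moves) and is the exact residual case 'special POINTS are defined over Q-bar' to
which KlinglerOtwinowskaUrbanik2023 Cor 1.14 reduce their Conjecture 1.5; known: CM points of
Shimura-type families, Saito-Schnell arXiv:1408.2488 (a special subvariety is defined over Q-bar iff
it contains a Q-bar point), Voisin2007HodgeLoci (absolute-Hodge criteria). Tools expected:
bi-algebraic / Ax-Schanuel transcendence for period maps, G-functions, o-minimal point counting.
Negative side = kill criterion K2: a certified rigid Hodge class at a transcendental modulus refutes
this item AND HodgeConjecture (cf -/
@[route_item "route-HodgeConjecture-FiniteTreeOfFlavours", crux]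
def RigidImpliesQbar : Prop :=
  ∀ ⦃n d : ℕ⦄ ⦃X : Literature.AlgebraicGeometry.Motives.SchemeOver ℂ⦄, Literature.AlgebraicGeometry.Motives.IsSmoothHypersurface n d X → ∀ (k : ℕ) (c : Literature.AlgebraicGeometry.HodgeTheory.complexBetti X (2 * k)), Literature.AlgebraicGeometry.HodgeTheory.IsRationalClass c → Literature.AlgebraicGeometry.HodgeTheory.IsOfHodgeType n X (2 * k) k k c → ¬ (∃ (𝒴 C : Literature.AlgebraicGeometry.Motives.SchemeOver ℂ) (π : 𝒴 ⟶ C) (t : Literature.AlgebraicGeometry.Motives.AlgPoints C ℂ) (e : X ≅ Literature.AlgebraicGeometry.Motives.fiberOver π t) (Λ : Literature.AlgebraicGeometry.HodgeTheory.complexBetti 𝒴 (2 * k)), Literature.AlgebraicGeometry.Motives.IsSmoothProjective (n + 1) 𝒴 ∧ Literature.AlgebraicGeometry.Motives.IsSmoothProjective 1 C ∧ Literature.AlgebraicGeometry.HodgeTheory.IsRationalClass Λ ∧ Literature.AlgebraicGeometry.HodgeTheory.IsOfHodgeType (n + 1) 𝒴 (2 * k) k k Λ ∧ (Literature.AlgebraicGeometry.HodgeTheory.complexBetti.map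 (CategoryTheory.CategoryStruct.comp e.hom (Literature.AlgebraicGeometry.Motives.fiberι π t)) (2 * k)).hom Λ = c ∧ Set.Finite {t' : Literature.AlgebraicGeometry.Motives.AlgPoints C ℂ | Nonempty (Literature.AlgebraicGeometry.Motives.fiberOver π t' ≅ X)}) → (∃ F : MvPolynomial (Fin (n + 2)) ℂ, F.IsHomogeneous d ∧ (∀ m, IsAlgebraic ℚ (F.coeff m)) ∧ Literature.AlgebraicGeometry.Motives.IsHypersurfaceCutOutBy (n + 1) F X)

/-- item stmt-HodgeConjecture-1495 · crux · rank 5 · open · by planner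
why it might fail: Rigid classes include every Hodge class of every CM hypersurface: HC is open already for Fermat degree 21+ in high dimension (Shioda's criterion fails, Aoki classes, fake linear cycles); non-CM rigid classes, if they exist, carry no structure to exploit.
sources: Shioda1979HodgeFermat, Deligne1982HodgeCycles, arXiv:2112.14818, BaldiKlinglerUllmo2024
[crux] Arithmetic heart: on a smooth (n,d)-hypersurface X isomorphic to one defined over Q-bar,
every RIGID rational (k,k)-class (one that does not move, as above) is algebraic. Contains HC for
all CM hypersurfaces (Mumford-Tate group a torus => every Hodge class rigid mod PGL): Fermat X^n_m
known for m prime or m <= 20 (Shioda1979HodgeFermat, Ran), open from m = 21 on in high dimension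
(Shioda's criterion P^n_m can fail; Aoki's non-standard classes; 'fake linear cycles'
arXiv:2112.14818); Delsarte hypersurfaces partially. Expected engines: inductive structure of
Fermat/Delsarte motives, CM abelian-type realisation + Deligne's absolute Hodge theorem
(Deligne1982HodgeCycles) + Andre motivated cycles, Tate-conjecture bridges over finite fields for
Q-bar-varieties. Open sub-question filed as support item NonCMRigidClassExists: is there ANY rigid
Hodge class on a non-CM smooth hypersurface with n >= 3, d >= 6 (BKU's zero-period-dimensional
atypical points 'about which we can't say anything', BaldiKlinglerUllmo2024 p.5)? A 'no' for given
(n,d) reduces this item there to the CM case. -/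
@[route_item "route-HodgeConjecture-FiniteTreeOfFlavours", crux]
def RigidQbarClassesAlgebraic : Prop :=
  ∀ ⦃n d : ℕ⦄ ⦃X : Literature.AlgebraicGeometry.Motives.SchemeOver ℂ⦄, Literature.AlgebraicGeometry.Motives.IsSmoothHypersurface n d X → (∃ F : MvPolynomial (Fin (n + 2)) ℂ, F.IsHomogeneous d ∧ (∀ m, IsAlgebraic ℚ (F.coeff m)) ∧ Literature.AlgebraicGeometry.Motives.IsHypersurfaceCutOutBy (n + 1) F X) → ∀ (k : ℕ) (c : Literature.AlgebraicGeometry.HodgeTheory.complexBetti X (2 * k)), Literature.AlgebraicGeometry.HodgeTheory.IsRationalClass c → Literature.AlgebraicGeometry.HodgeTheory.IsOfHodgeType n X (2 * k) k k c → ¬ (∃ (𝒴 C : Literature.AlgebraicGeometry.Motives.SchemeOver ℂ) (π : 𝒴 ⟶ C) (t : Literature.AlgebraicGeometry.Motives.AlgPoints C ℂ) (e : X ≅ Literature.AlgebraicGeometry.Motives.fiberOver π t) (Λ : Literature.AlgebraicGeometry.HodgeTheory.complexBetti 𝒴 (2 * k)), Literature.AlgebraicGeometry.Motives.IsSmoothProjective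 (n + 1) 𝒴 ∧ Literature.AlgebraicGeometry.Motives.IsSmoothProjective 1 C ∧ Literature.AlgebraicGeometry.HodgeTheory.IsRationalClass Λ ∧ Literature.AlgebraicGeometry.HodgeTheory.IsOfHodgeType (n + 1) 𝒴 (2 * k) k k Λ ∧ (Literature.AlgebraicGeometry.HodgeTheory.complexBetti.map (CategoryTheory.CategoryStruct.comp e.hom (Literature.AlgebraicGeometry.Motives.fiberι π t)) (2 * k)).hom Λ = c ∧ Set.Finite {t' : Literature.AlgebraicGeometry.Motives.AlgPoints C ℂ | Nonempty (Literature.AlgebraicGeometry.Motives.fiberOver π t' ≅ X)}) → c ∈ Literature.AlgebraicGeometry.HodgeTheory.algebraicClasses X k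

/-- item stmt-HodgeConjecture-1496 · support · rank 9 · open · by planner
sources: Thomas2005Nodes
[support] SCOPE MARKER, deliberately NOT a crux and not to be staffed before the cruxes move: the
OPEN reduction 'cycle part of HC for all smooth hypersurfaces of P^{n+1} (all n, d) => cycle part of
HC for all smooth projective varieties'. No mechanism is claimed; the statement is implied by
HodgeConjecture itself, so it is irrefutable short of refuting HC, and a proof would be a major
theorem. Nearest known reduction: Thomas2005Nodes Thm 1 (HC <=> a homology-lifting question for
NODAL hypersurface SECTIONS D in |O_X(N)| of each even-dimensional X) — sections of X, not
hypersurfaces of projective space; Prop. 2 there (middle degree on even-dimensional varieties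
suffices) is the standard first step. The route's deliverable is the target HypersurfaceHodge; this
item only carries the assembly to the summit constant. -/
@[route_item "route-HodgeConjecture-FiniteTreeOfFlavours", crux]
def HypersurfacesSuffice : Prop :=
  (∀ ⦃n d : ℕ⦄ ⦃X : Literature.AlgebraicGeometry.Motives.SchemeOver ℂ⦄, Literature.AlgebraicGeometry.Motives.IsSmoothHypersurface n d X → ∀ (k : ℕ) (c : Literature.AlgebraicGeometry.HodgeTheory.complexBetti X (2 * k)), Literature.AlgebraicGeometry.HodgeTheory.IsRationalClass c → Literature.AlgebraicGeometry.HodgeTheory.IsOfHodgeType n X (2 * k) k k c → c ∈ Literature.AlgebraicGeometry.HodgeTheory.algebraicClasses X k) → ∀ ⦃n : ℕ⦄ ⦃X : Literature.AlgebraicGeometry.Motives.SchemeOver ℂ⦄, Literature.AlgebraicGeometry.Motives.IsSmoothProjective n X → ∀ (k : ℕ) (c : Literature.AlgebraicGeometry.HodgeTheory.complexBetti X (2 * k)), Literature.AlgebraicGeometry.HodgeTheory.IsRationalClass c → Literature.AlgebraicGeometry.HodgeTheory.IsOfHodgeType n X (2 * k) k k c → c ∈ Literature.AlgebraicGeometry.HodgeTheory.algebraicClasses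 X k

-- item stmt-HodgeConjecture-1595 · support · rank 9 · open · by planner — informal only, no Lean statement yet:
--   [support] OPEN SUB-QUESTION (card T2c), informal until 'Mumford–Tate group of H^n(X(ℂ),ℚ)' is a Lean
--   notion for honest singular cohomology: does there exist a smooth hypersurface X ⊂ P^{n+1}_ℂ with n ≥
--   3, d ≥ 6 (BKU level ≥ 3 regime) whose Hodge structure H^n(X,ℚ)_prim is NOT of CM type (Mumford–Tate
--   group not a torus) carrying a RIGID non-zero primitive rational (n/2,n/2)-class c (rigid = ¬Moves as
--   in crux RigidImpliesQbar: no smooth projective (n+1)-fold over a curve through X, non-isotrivial at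
--   X, carries a rational Hodge class restricting to c)? These are exactly BKU's atypical points of z

/-- item stmt-HodgeConjecture-2742 · support · rank 9 · closed · proved by Summit.HodgeConjecture.HodgeConjecture.Theorems.holomorphicDefect_hodgeModelsExist_proof @ 852a466105f7 (prover) · by planner
sources: SerreGAGA1956, VoisinHodgeI2002, deRham1931, Deligne2000
[support] = ∀ n X, Literature.AlgebraicGeometry.HodgeTheory.nonempty_hodgeModel n X (Serre GAGA §2 +
de Rham + the Hodge decomposition of the compact Kähler X^an); tree named fact, discharge in
progress (HodgeModelExistenceDischarge). [difficulty: L] -/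
@[route_item "route-HodgeConjecture-FiniteTreeOfFlavours", crux]
def HodgeModelsExist : Prop :=
  ∀ (n : ℕ) (X : Literature.AlgebraicGeometry.Motives.SchemeOver ℂ), Literature.AlgebraicGeometry.Motives.IsSmoothProjective n X → Nonempty (Literature.AlgebraicGeometry.HodgeTheory.HodgeModel n X)

/-- `HodgeModelsExist` holds: proved by `Summit.HodgeConjecture.HodgeConjecture.Theorems.holomorphicDefect_hodgeModelsExist_proof` @ 852a466105f7. -/
theorem HodgeModelsExist_holds : HodgeModelsExist := _root_.Summit.HodgeConjecture.HodgeConjecture.Theorems.holomorphicDefect_hodgeModelsExist_proof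

/-- item stmt-HodgeConjecture-14377 · support · rank 10 · closed · proved by Summit.HodgeConjecture.HodgeConjecture.Theorems.finiteTreeOfFlavours_hypersurfaceHodgeFromCruxes_proof @ 006265ca4120 (prover) · by planner
sources: Deligne2000, BaldiKlinglerUllmo2024, KlinglerOtwinowskaUrbanik2023
[support] GLUE to the target (route-choice 2026-08-16, clears route.target-unreachable): the thesis
X = HypersurfaceHodge (HC for every smooth hypersurface of P^{n+1}_C) follows from the three general
cruxes and the route's support item HodgeModelsExist (the Hodge-model conjunct, via
IsSmoothHypersurface.1 : IsSmoothProjective) by the tautological MOVABLE/RIGID case split on a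
rational (k,k)-class c: if c moves it is algebraic by MovableClassesAlgebraic; if not,
RigidImpliesQbar gives a Q-bar-form of X and RigidQbarClassesAlgebraic makes c algebraic. Pure logic
(Classical.em) — the deciding theorem `closes` one level down, without the bridge
HypersurfacesSuffice. Provable now: planner Sketch.lean `hypersurfaceHodgeFromCruxes_holds`, lean
check rc 0, 0 sorry, axioms {propext, Classical.choice, Quot.sound}. The (4,6) testbed crux
MovableClassesAlgebraicSextic is a special case of MovableClassesAlgebraic and deliberately not an
antecedent. Rank 10 (not 9) only so that the gate renders this def AFTER the rank-9 support
HodgeModelsExist it mentions (render order = rank, then item id as a string); supersedes the rank-9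
spelling HypersurfaceHodgeOfCruxes (stmt-HodgeConjecture-14222, dropp -/
@[route_item "route-HodgeConjecture-FiniteTreeOfFlavours"]
def HypersurfaceHodgeFromCruxes : Prop :=
  MovableClassesAlgebraic → RigidImpliesQbar → RigidQbarClassesAlgebraic → HodgeModelsExist → HypersurfaceHodge

-- `HypersurfaceHodgeFromCruxes` holds: proved by `Summit.HodgeConjecture.HodgeConjecture.Theorems.finiteTreeOfFlavours_hypersurfaceHodgeFromCruxes_proof` @ 006265ca4120 (its module imports this route file, so no `_holds` link can be stated here).

-- earlier Assembly (stmt-HodgeConjecture-1497, replaced 2026-08-15T16:24:07Z -> stmt-HodgeConjecture-10789): retired by None — (∀ (n : ℕ) (X : Literature.AlgebraicGeometry.Motives.SchemeOver ℂ), Literature.AlgebraicGeometry.HodgeTheory.nonempty_hodgeModel n X) → MovableClassesAlgebraic → RigidImpliesQbar → RigidQbarClassesAlgebraic → HypersurfacesSuffice → HodgeConjecture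
/-- item stmt-HodgeConjecture-10789 · assembly · rank 1 · closed · proved by Summit.HodgeConjecture.HodgeConjecture.Theorems.finiteTreeOfFlavours_assembly_proof @ 56db29b4b4db (prover) · by planner
sources: Deligne2000
[assembly] HodgeModelsExist → MovableClassesAlgebraic → RigidImpliesQbar → RigidQbarClassesAlgebraic
→ HypersurfacesSuffice → HodgeConjecture: exactly the type of the deciding theorem `closes` (pure
logic: Hodge-model conjunct from HodgeModelsExist; cycle part = HypersurfacesSuffice applied to the
movable/rigid case split on smooth hypersurfaces). Provable now as `closes`. [deps:
HodgeModelsExist, MovableClassesAlgebraic, RigidImpliesQbar, RigidQbarClassesAlgebraic,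
HypersurfacesSuffice] [difficulty: provable-now] -/
@[route_item "route-HodgeConjecture-FiniteTreeOfFlavours"]
def Assembly : Prop :=
  HodgeModelsExist → MovableClassesAlgebraic → RigidImpliesQbar → RigidQbarClassesAlgebraic → HypersurfacesSuffice → _root_.HodgeConjecture

-- `Assembly` holds: proved by `Summit.HodgeConjecture.HodgeConjecture.Theorems.finiteTreeOfFlavours_assembly_proof` @ 56db29b4b4db (its module imports this route file, so no `_holds` link can be stated here).

/-! D-0027 §2.1 — DECIDING THEOREM (planner-authored via `route open/edit --closes-file`; by planner-rbadge-HodgeConjecture-FiniteTreeOfFla-060ab0f9-g2-0 2026-08-15T16:24:07Z):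
its hypotheses are this route's items and its conclusion the sub-problem Statement (glue_lint), and it elaborates with this file. -/

/-- Deciding theorem of route FiniteTreeOfFlavours (D-0027 §2.1). For a smooth projective `X`,
the Hodge-model conjunct of `HodgeConjectureFor n X` is the support item `HodgeModelsExist`
(Serre GAGA + de Rham + Hodge decomposition, written out over `HodgeModel`); the cycle part is
`HypersurfacesSuffice` applied to the cycle part of HC for all smooth hypersurfaces, which is the
tautological MOVABLE / RIGID case split: a rational `(k,k)`-class that moves is algebraic by
`MovableClassesAlgebraic`; one that does not forces a `ℚ̄`-form of `X` by `RigidImpliesQbar` and is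
then algebraic by `RigidQbarClassesAlgebraic`. Pure logic (`Classical.em`). -/
@[closes "route-HodgeConjecture-FiniteTreeOfFlavours"] theorem closes (hM : HodgeModelsExist) (h₃ : MovableClassesAlgebraic) (h₄ : RigidImpliesQbar)
    (h₅ : RigidQbarClassesAlgebraic) (h₆ : HypersurfacesSuffice) : _root_.HodgeConjecture := by
  intro n X hX
  refine ⟨hM n X hX, h₆ ?_ hX⟩
  intro m d Y hY k c hc hkk
  refine (Classical.em _).elim (fun hmov => h₃ hY k c hc hkk hmov) (fun hrig => ?_)
  exact h₅ hY (h₄ hY k c hc hkk hrig) k c hc hkk hrig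

end Summit.HodgeConjecture.HodgeConjecture.Theses.FiniteTreeOfFlavours
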